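import Summits.RiemannHypothesis.RiemannHypothesis.Theorems.TiltedLandingLaw421R3Lens1CoverageW

/-! # Lens-1 COVERAGE THEOREM (file R: the lateral isolation certificate «E-isoL», the CELL-FREE residual stubs `RegRes8` (door currency) / `RegRes8S` (successor currency), and the compositions of record `TiltedLandingLaw421R_of_res` / `_of_resS`; director (CA463)/(CA473) design)

Imports file W (`…R3Lens1CoverageW`: `LandingDipW`, `regime_LW`, `RegLfarW8`, `_of_regimes5`; transitively files A–D, the quantitative
Jensen dips and the one-body U lemmas v3 `…R3Lens1OneBodyU`: `RhW08.Lens1OneBody.succ_of_isolated_pt`).  Declares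
* `IsolatedNewtonL` — the isolation certificate of file D with the COLUMN clause replaced by the level-`(j+1)` window taken POINTWISE on the
  disc (the disc may overhang the column edge where the lateral budget allows), `isolatedNewtonL_of_isolatedNewton` (column ⇒ lateral),
  `regime_EisoL` (PROVED, successor currency: `succ_of_isolated_pt`) — owner candidate for the `RegEres8` rows at a column edge;
* `RegRes8` — ONE cell-free residual stub: the SUCC-law binders and the negation of every PROVED certificate (floor `CellF`, child fit
  `CellNb`, deep landing dip, weighted landing dip `LandingDipW` (⊇ `LandingDipQ`), lateral isolation `IsolatedNewtonL` (⊇ `IsolatedNewton`))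
  ⇒ a Q8 door; `regRes8_of_doorAvailLawQ8` (weaker than the SUCC law BY NAME) and `regRes8_of_regimes5` (implied by the three v5 stubs
  `RegCov8 ∧ RegLfarW8 ∧ RegEres8` jointly — so never stronger than the rung it replaces; the cover cell C is absorbed);
* `antiEscapeCore_of_res` / `restSuccBotQ_of_res` / `TiltedLandingLaw421R_of_res : RegRes8 → RateLawsHalfQ → crux`, sanity `_of_regimes5'`;
* (v3, (CA473)(4)) the same residual in SUCCESSOR currency: `RegRes8S` (same binders and exclusions ⇒ `∃ u, StTrkDQ … (j+1) u`, exactly what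
  the composition consumes), `regRes8S_of_regRes8` (door ⇒ successor), `regRes8S_of_doorAvailLawQ8`, `antiEscapeCore_of_resS`,
  `restSuccBotQ_of_resS`, `TiltedLandingLaw421R_of_resS : RegRes8S → RateLawsHalfQ → crux` — the WEAKEST stub that composes (a frame with a
  successor but no door cannot kill it; its kill is a frame with NO successor in the window).
0 sorry.  Nothing here bears on the truth of RH; RH is not proved; the crux ⟨33346⟩ stays OPEN (`RegRes8` and lens-2's `RateLawsHalfQ` are
hypotheses of the composition). -/

namespace RhW08.Lens1Coverage

set_option linter.dupNamespace false

open Complex Set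
open scoped ComplexConjugate
open Literature.Analysis.Complex
open Summit.RiemannHypothesis.RiemannHypothesis.Theorems.Splittings.JensenWindow
open RhIdea6.G17.W07C7 RhIdea6.G17.W07C7.Rev6 RhIdea6.G18.W07C8.Law421BirthS RhIdea6.G19.W07C11.Seam
open RhIdea6.G20.W07C12.Frac RhIdea6.G20.W07C12.StColP RhW07.C12.FieldSplit RhIdea6.G21.W07C13.TentMax
open RhW07.C14.TwoSided RhW07.C14.Classes RhW07.C14.Lineage RhW07.C14.Booking
open RhW07.C13.Heredity RhIdea6.G22.W07C15pre.Injection RhW07.E3.Cell RhW07.E3.Lit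
open RhW08.Round1 RhW08.StSwap RhW08.Round2 RhW08.QuadW RhW08.SealSwapQ RhW08.SealSwap RhW08.SuccB RhW08.SuccSplit
open RhW08.SuccTheft RhW08.Column RhW08.Hurwitz RhW08.ClusterQ RhW08.ClusterQM RhW08.NewtonDoor RhW08.NewtonDoorGenusOne RhW08.PurseP
open RhW08.AntiEscapeSplit7

/-! ## §22 The lateral isolation certificate «E-isoL» -/

/-- CELL DATUM «E-isoL» (LATERAL ISOLATION CERTIFICATE at `v`, level `j`): the data of `IsolatedNewton` (disc `D(c, ρ)`, `‖v − c‖ < ρ ≤ Im c`,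
every other zero of `f^{(j)}` strictly outside `D̄(c, ρ)`, a witness `K : ℂ` with a zero of the model `1 + K(z − v)` inside, the pointwise
variation clause on the circle) with the COLUMN clause replaced by the level-`(j+1)` window POINTWISE on the disc:
`∀ z ∈ D(c, ρ), |Im z| ≤ Hs → max(|Re z − x₀| − R/2, 0)² + (j+1)·(Im z)² ≤ (j+1)·Hs²` (= the hypotheses of
`RhW08.Lens1OneBody.succ_of_isolated_pt`, letter for letter). -/
def IsolatedNewtonL (f : ℂ → ℂ) (x₀ R Hs : ℝ) (j : ℕ) (v : ℂ) : Prop :=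
  ∃ (c : ℂ) (ρ : ℝ) (K : ℂ), 0 < ρ ∧ ‖v - c‖ < ρ ∧ ρ ≤ c.im ∧
    (∀ z : ℂ, iteratedDeriv j f z = 0 → z ≠ v → ρ < ‖z - c‖) ∧
    (∃ z₀ : ℂ, ‖z₀ - c‖ < ρ ∧ 1 + K * (z₀ - v) = 0) ∧
    (∀ z : ℂ, ‖z - c‖ = ρ →
      ‖z - v‖ * ‖deriv (dslope (iteratedDeriv j f) v) z / dslope (iteratedDeriv j f) v z - K‖ < ‖1 + K * (z - v)‖) ∧
    ∀ z : ℂ, ‖z - c‖ < ρ → |z.im| ≤ Hs → (max (|z.re - x₀| - R / 2) 0) ^ 2 + ((j : ℝ) + 1) * z.im ^ 2 ≤ ((j : ℝ) + 1) * Hs ^ 2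

/-- Column ⇒ lateral: an isolation certificate inside the column is a lateral one (the aperture term vanishes on the disc). -/
theorem isolatedNewtonL_of_isolatedNewton {f : ℂ → ℂ} {x₀ R Hs : ℝ} {j : ℕ} {v : ℂ} (h : IsolatedNewton f x₀ R j v) :
    IsolatedNewtonL f x₀ R Hs j v := by
  obtain ⟨c, ρ, K, hρ, hvc, hρc, hcol, hiso, hMz, hvar⟩ := h
  refine ⟨c, ρ, K, hρ, hvc, hρc, hiso, hMz, hvar, ?_⟩
  intro z hz hzim
  have hre : |z.re - x₀| ≤ R / 2 := by
    have h1 : |(z - c).re| ≤ ‖z - c‖ := Complex.abs_re_le_norm _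
    simp only [Complex.sub_re] at h1
    have h2 : |z.re - x₀| ≤ |z.re - c.re| + |c.re - x₀| := by
      have := abs_add_le (z.re - c.re) (c.re - x₀)
      rwa [show z.re - c.re + (c.re - x₀) = z.re - x₀ by ring] at this
    linarith
  have hmax : max (|z.re - x₀| - R / 2) 0 = 0 := max_eq_right (by linarith)
  rw [hmax]
  have hsq : z.im ^ 2 ≤ Hs ^ 2 := by
    have := sq_abs z.im
    rw [← this]
    exact pow_le_pow_left₀ (abs_nonneg _) hzim 2
  have hj : (0 : ℝ) ≤ (j : ℝ) + 1 := by positivity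
  nlinarith [mul_le_mul_of_nonneg_left hsq hj]

/-- ★ REGIME LEMMA «E-isoL» (PROVED, successor currency): frame + a state `v` at level `j` with `f^{(j+1)} v ≠ 0` and a lateral isolation
certificate ⇒ a successor at level `j+1` (`RhW08.Lens1OneBody.succ_of_isolated_pt`; no door, no count clause). -/
theorem regime_EisoL {η : ℝ} {f : ℂ → ℂ} {x₀ s hmax R Hs : ℝ} {B j : ℕ} {v : ℂ}
    (hE : EngineHyps5 2 η f x₀ s hmax R Hs B) (hst : StTrkDQ η f x₀ s hmax R Hs B j v) (hv1 : iteratedDeriv (j + 1) f v ≠ 0)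
    (h : IsolatedNewtonL f x₀ R Hs j v) : ∃ u : ℂ, StTrkDQ η f x₀ s hmax R Hs B (j + 1) u := by
  obtain ⟨c, ρ, K, hρ, hvc, hρc, hiso, hMz, hvar, hdisc⟩ := h
  exact RhW08.Lens1OneBody.succ_of_isolated_pt hE hst hv1 hρ hvc hρc hiso hMz hvar hdisc

/-! ## §23 The cell-free residual stub `RegRes8` and the composition of record -/

/-- (R) THE CELL-FREE RESIDUAL STUB (director (CA463)), Q8-door currency: the SUCC-law binders and NONE of the proved certificates —
no floor certificate `CellF`, no child fit `CellNb`, no deep landing dip, no weighted landing dip, no lateral isolation certificate — ⇒ one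
of the six Q8 doors.  Weaker than `RhW08.LandingDoor.DoorAvailLawQ8` by name (`regRes8_of_doorAvailLawQ8`) and implied by the three v5
stubs jointly (`regRes8_of_regimes5`).  Its population on a table = the rows with no certificate (TABLE S: the 20 column-edge E rows and
the 7 `RegLfar8` rows, pending K-C5W / K-C6c). -/
def RegRes8 : Prop :=
  ∀ (η : ℝ) (f : ℂ → ℂ) (x₀ s hmax R Hs : ℝ) (B : ℕ), EngineHyps5 2 η f x₀ s hmax R Hs B → ∀ (j : ℕ) (v : ℂ),
    IsLowest StTrkDQ η f x₀ s hmax R Hs B j v → ¬ ReadyR2 η f x₀ s hmax R Hs B j v →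
    ¬ AllInBandInRangeWindow f x₀ R Hs j v → ¬ Dimple f j v → DiscOverlap f j v →
    iteratedDeriv (j + 1) f v ≠ 0 →
    ¬ CellF f j v → ¬ CellNb f x₀ R Hs j v → ¬ LandingDipDeep f x₀ R Hs j v → ¬ LandingDipW f x₀ R Hs j v →
    ¬ IsolatedNewtonL f x₀ R Hs j v → Doors8 f x₀ R Hs j v

/-- Monotonicity: the SUCC law of record implies the cell-free stub (drop the five negations). -/
theorem regRes8_of_doorAvailLawQ8 (hL8 : RhW08.LandingDoor.DoorAvailLawQ8) : RegRes8 :=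
  fun η f x₀ s hmax R Hs B hE j v hlow hnR hwin hdim hov hz _ _ _ _ _ =>
    hL8 η f x₀ s hmax R Hs B hE j v hlow hnR hwin hdim hov hz

/-- Monotonicity: the three v5 stubs (`RegCov8`, `RegLfarW8`, `RegEres8`) jointly imply the cell-free stub (route the row by `cells_cover`;
cells F and N♭ are excluded by hypothesis, the cover cell is served by `RegCov8`, the rest by the residual stubs). -/
theorem regRes8_of_regimes5 (hC : RegCov8) (hL : RegLfarW8) (hX : RegEres8) : RegRes8 := by
  intro η f x₀ s hmax R Hs B hE j v hlow hnR hwin hdim hov hz hnF hnNb hnD hnW hnI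
  rcases cells_cover f x₀ R Hs j v with h | h | h | h | h
  · exact hC η f x₀ s hmax R Hs B hE j v hlow hnR hwin hdim hov hz h (exists_cover_of_coverIndex_pos_frame hE hlow.1 hz h)
  · exact absurd h hnF
  · exact absurd h hnNb
  · exact hL η f x₀ s hmax R Hs B hE j v hlow hnR hwin hdim hov hz h hnD hnW
  · exact hX η f x₀ s hmax R Hs B hE j v hlow hnR hwin hdim hov hz h (fun hI => hnI (isolatedNewtonL_of_isolatedNewton hI))

/-- ★ (R) `AntiEscapeCore` from the cell-free stub: a multiple zero by `succ_of_multiple`, each certificate by its PROVED regime lemma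
(`regime_F`, `regime_Nb`, `regime_Ldeep`, `regime_LW`, `regime_EisoL`), everything else by the stub's door (`succ_of_doors8`).  No cells. -/
theorem antiEscapeCore_of_res (hRB : RealCritBoundNSig) (hX : RegRes8) : AntiEscapeCore := by
  intro η f x₀ s hmax R Hs B hE j v hlow hnR hwin hdim hov
  by_cases hz : iteratedDeriv (j + 1) f v = 0
  · exact succ_of_multiple hE hlow.1 hz
  by_cases hF : CellF f j v
  · exact regime_F hE hlow.1 hF
  by_cases hNb : CellNb f x₀ R Hs j v
  · exact regime_Nb hE hlow.1 hNb
  by_cases hD : LandingDipDeep f x₀ R Hs j v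
  · exact regime_Ldeep hE hD
  by_cases hW : LandingDipW f x₀ R Hs j v
  · exact regime_LW hE hW
  by_cases hI : IsolatedNewtonL f x₀ R Hs j v
  · exact regime_EisoL hE hlow.1 hz hI
  exact succ_of_doors8 hRB hE hlow hnR (hX η f x₀ s hmax R Hs B hE j v hlow hnR hwin hdim hov hz hF hNb hD hW hI)

/-- `RestSuccBotQ` from the cell-free stub, via `antiEscapeCore_of_res`. -/
theorem restSuccBotQ_of_res (hRB : RealCritBoundNSig) (hX : RegRes8) : RestSuccBotQ :=
  restSuccBotQ_of_pieces dimpleSig_holds (antiEscape_of_core (antiEscapeCore_of_res hRB hX))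

/-- ★★ (R) THE CRUX BY NAME from the cell-free stub and lens-2's rate law (director (CA463): `TiltedLandingLaw421R_of_res`). -/
theorem TiltedLandingLaw421R_of_res (hX : RegRes8) (hR : RhW08.RateSplit.RateLawsHalfQ) :
    Summit.RiemannHypothesis.RiemannHypothesis.Theses.EarlyAppointments.TiltedLandingLaw421R :=
  law421Half_of_succ_rate (restSuccBotQ_of_res RhW08.ClusterQM.realCritBoundNSig_holds hX)
    (RhW08.RateSplit.restRateBotPQ_half_of_rateLaws hR)

/-- Sanity (v5 ⇒ R): file W's hypotheses still close the crux through this file. -/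
theorem TiltedLandingLaw421R_of_regimes5' (hC : RegCov8) (hL : RegLfarW8) (hX : RegEres8) (hR : RhW08.RateSplit.RateLawsHalfQ) :
    Summit.RiemannHypothesis.RiemannHypothesis.Theses.EarlyAppointments.TiltedLandingLaw421R :=
  TiltedLandingLaw421R_of_res (regRes8_of_regimes5 hC hL hX) hR

/-! ## §24 The residual in SUCCESSOR currency (v3, (CA473)(4)) -/

/-- (R-S) THE CELL-FREE RESIDUAL STUB IN SUCCESSOR CURRENCY: the binders and exclusions of `RegRes8`, concluding directly with a level-`(j+1)`
band state — exactly what `antiEscapeCore_of_res` consumes from the stub.  Weaker than `RegRes8` (`regRes8S_of_regRes8`: a door opens), hence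
than the SUCC law of record; NOT killed by a frame that has a successor but no door (edge double-pair corners, (CA473)); its kill is a frame
meeting the binders and exclusions with NO level-`(j+1)` state in the window. -/
def RegRes8S : Prop :=
  ∀ (η : ℝ) (f : ℂ → ℂ) (x₀ s hmax R Hs : ℝ) (B : ℕ), EngineHyps5 2 η f x₀ s hmax R Hs B → ∀ (j : ℕ) (v : ℂ),
    IsLowest StTrkDQ η f x₀ s hmax R Hs B j v → ¬ ReadyR2 η f x₀ s hmax R Hs B j v →
    ¬ AllInBandInRangeWindow f x₀ R Hs j v → ¬ Dimple f j v → DiscOverlap f j v →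
    iteratedDeriv (j + 1) f v ≠ 0 →
    ¬ CellF f j v → ¬ CellNb f x₀ R Hs j v → ¬ LandingDipDeep f x₀ R Hs j v → ¬ LandingDipW f x₀ R Hs j v →
    ¬ IsolatedNewtonL f x₀ R Hs j v → ∃ u : ℂ, StTrkDQ η f x₀ s hmax R Hs B (j + 1) u

/-- Door ⇒ successor: the door-currency stub implies the successor-currency stub (`succ_of_doors8`, real pigeonhole
`RhW08.ClusterQM.realCritBoundNSig_holds`). -/
theorem regRes8S_of_regRes8 (hX : RegRes8) : RegRes8S :=
  fun η f x₀ s hmax R Hs B hE j v hlow hnR hwin hdim hov hz hnF hnNb hnD hnW hnI =>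
    succ_of_doors8 RhW08.ClusterQM.realCritBoundNSig_holds hE hlow hnR
      (hX η f x₀ s hmax R Hs B hE j v hlow hnR hwin hdim hov hz hnF hnNb hnD hnW hnI)

/-- Monotonicity: the SUCC law of record implies the successor-currency stub. -/
theorem regRes8S_of_doorAvailLawQ8 (hL8 : RhW08.LandingDoor.DoorAvailLawQ8) : RegRes8S :=
  regRes8S_of_regRes8 (regRes8_of_doorAvailLawQ8 hL8)

/-- Monotonicity: the three v5 stubs jointly imply the successor-currency stub. -/
theorem regRes8S_of_regimes5 (hC : RegCov8) (hL : RegLfarW8) (hX : RegEres8) : RegRes8S :=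
  regRes8S_of_regRes8 (regRes8_of_regimes5 hC hL hX)

/-- ★ (R-S) `AntiEscapeCore` from the successor-currency stub: a multiple zero by `succ_of_multiple`, each certificate by its PROVED regime
lemma, everything else IS the stub.  No doors, no cells, no real-pigeonhole hypothesis. -/
theorem antiEscapeCore_of_resS (hX : RegRes8S) : AntiEscapeCore := by
  intro η f x₀ s hmax R Hs B hE j v hlow hnR hwin hdim hov
  by_cases hz : iteratedDeriv (j + 1) f v = 0
  · exact succ_of_multiple hE hlow.1 hz
  by_cases hF : CellF f j v
  · exact regime_F hE hlow.1 hF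
  by_cases hNb : CellNb f x₀ R Hs j v
  · exact regime_Nb hE hlow.1 hNb
  by_cases hD : LandingDipDeep f x₀ R Hs j v
  · exact regime_Ldeep hE hD
  by_cases hW : LandingDipW f x₀ R Hs j v
  · exact regime_LW hE hW
  by_cases hI : IsolatedNewtonL f x₀ R Hs j v
  · exact regime_EisoL hE hlow.1 hz hI
  exact hX η f x₀ s hmax R Hs B hE j v hlow hnR hwin hdim hov hz hF hNb hD hW hI

/-- `RestSuccBotQ` from the successor-currency stub, via `antiEscapeCore_of_resS`. -/
theorem restSuccBotQ_of_resS (hX : RegRes8S) : RestSuccBotQ :=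
  restSuccBotQ_of_pieces dimpleSig_holds (antiEscape_of_core (antiEscapeCore_of_resS hX))

/-- ★★ (R-S) THE CRUX BY NAME from the successor-currency stub and lens-2's rate law ((CA473)(4): `TiltedLandingLaw421R_of_resS`; registry
DRAFT-7b = stubs `RegRes8S`, `RateLawsHalfQ`). -/
theorem TiltedLandingLaw421R_of_resS (hX : RegRes8S) (hR : RhW08.RateSplit.RateLawsHalfQ) :
    Summit.RiemannHypothesis.RiemannHypothesis.Theses.EarlyAppointments.TiltedLandingLaw421R :=
  law421Half_of_succ_rate (restSuccBotQ_of_resS hX) (RhW08.RateSplit.restRateBotPQ_half_of_rateLaws hR)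

/-- Sanity (R ⇒ R-S): the door-currency stub still closes the crux through the successor-currency composition. -/
theorem TiltedLandingLaw421R_of_res' (hX : RegRes8) (hR : RhW08.RateSplit.RateLawsHalfQ) :
    Summit.RiemannHypothesis.RiemannHypothesis.Theses.EarlyAppointments.TiltedLandingLaw421R :=
  TiltedLandingLaw421R_of_resS (regRes8S_of_regRes8 hX) hR

end RhW08.Lens1Coverage
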